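import Summits.BirchSwinnertonDyer.BirchSwinnertonDyer.Theorems.GenusKolyvaginAtTwoGenusDeepSupplyAtTwoNegDiscNarrowKFourCellKolyvaginClass
import HarnessLib

/-!
# Route `GenusKolyvaginAtTwo`, crux 23491, K₄ cell: THE K₄′ READING AT A SINGLE KOLYVAGIN PRIME, MODULO NAMED ITEMS ONLY (Q2, Poitou–Tate, Euler–Poincaré)

LEAD seat `bsd-line-gk2-p1` g22, `--supports stmt-BirchSwinnertonDyer-23491 --as helper`; one-theorem sequel of p767174/p767500 (§5 ∘ §6).  THEOREMS ONLY.
**BSD is NOT proved by this file; K₄′ is NOT claimed; nothing is closed.**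

`exists_compatible_datum_kolyvaginClass_two_descends_of_cell` — on the K₄ cell of crux 23491 (prime frame; `M₀ ≥ 1`), GIVEN the route item Q2
`KolyvaginRelationAtTwo` and the two print facts of p766389: for EVERY Kolyvagin prime `ℓ` at `2` there is a datum `d` of conductor `1·ℓ`, McCallum-compatible
with the conductor-`1` datum `d₁`, whose level-1 class `c₁(ℓ) ∈ H¹(K, E[2])` is `res_K s` for a UNIQUE `s`, with `s ∈ Sel₂(E/ℚ)`, and
`c₁(ℓ) ≠ 0 ⟺ P(1·ℓ) ∉ 2E(K[1·ℓ])`.  So a K₄′ witness at the single deep prime `ℓ` (for this `d`) is EXACTLY a level-1 Kolyvagin class realising a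
non-zero element of `Sel₂(E/ℚ) ≅ Ш(E/ℚ)[2] ≅ (ℤ/2)²`.  CONDITIONAL (Q2, hPT, hEP).  [cite: McCallumLMS1991, §4 Prop. 4.4, Cor. 4.5]
[cite: GrossLMS1991, §4 (4.4), §6 Prop. 6.2] [cite: Kramer1981, Thm. 1]
-/

set_option linter.dupNamespace false -- tree convention (D-0017)
set_option autoImplicit false

noncomputable section

open scoped Classical

namespace Summit.BirchSwinnertonDyer.BirchSwinnertonDyer.Theorems.GenusSupplyNarrow.KFourCell

open WeierstrassCurve NumberField IsDedekindDomain Field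
open Literature.NumberTheory.EllipticCurves Literature.NumberTheory.GaloisRepresentations
open Literature.NumberTheory.GaloisCohomology Literature.NumberTheory.EllipticCurves.ModularForms
open Summit.BirchSwinnertonDyer.BirchSwinnertonDyer.Theses.GenusKolyvaginAtTwo (KolyvaginRelationAtTwo)
open Summit.BirchSwinnertonDyer.Rank1Residual.X11b

/-- **The K₄′ reading at one Kolyvagin prime, modulo Q2 / Poitou–Tate / Euler–Poincaré.**  See the module docstring.  (§6 of p767500 supplies the compatible
datum and its Selmer condition at `λ ∣ ℓ`; §5 — with the family `{1 ↦ d₁, 1·ℓ ↦ d}` — descends the class and reads `c₁ ≠ 0` as `P ∉ 2E`.)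
CONDITIONAL.  BSD is NOT proved by this. [cite: McCallumLMS1991, §4 Prop. 4.4, Cor. 4.5] [cite: GrossLMS1991, §4 (4.4), §6 Prop. 6.2] [cite: Kramer1981, Thm. 1] -/
theorem exists_compatible_datum_kolyvaginClass_two_descends_of_cell
    (W : WeierstrassCurve ℚ) [W.IsElliptic] [W.IsGloballyMinimal] [NeZero (W.conductorNorm ℤ)] (K : Type) [Field K] [NumberField K]
    (hQ2 : KolyvaginRelationAtTwo) (hPT : poitouTate_selmerStructure_duality_real ℚ)
    (hEP : ∀ v : HeightOneSpectrum (𝓞 ℚ), localEulerPoincareCharacteristic (v.adicCompletion ℚ))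
    (hcm : ¬ W.HasCM) (hΔ : W.Δ < 0) (hρ : ∀ m : ℕ, W.HasSurjectiveModNGaloisRep (2 ^ m : ℕ)) (hT : Odd W.tamagawaProduct)
    (h4 : Nat.card (W.selmerGroup 2) = 4) (hK : IsImaginaryQuadratic K) (hodd : Odd (discr K)) (h3 : discr K ≠ -3)
    (hH : SatisfiesHeegnerHypothesis (W.conductorNorm ℤ) K) (h2K : ((Ideal.span {(2 : ℤ)}).primesOver (𝓞 K)).ncard = 2)
    {ℓ₀ : ℕ} [Fact ℓ₀.Prime] (hd : discr K = -(ℓ₀ : ℤ))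
    (Wd : WeierstrassCurve ℚ) [Wd.IsElliptic] (hWd : ∃ C : VariableChange ℚ, C • W.quadraticTwist (discr K : ℚ) = Wd)
    (hSel : Nat.card (Wd.selmerGroup 2) = 2)
    (hL : ∀ P : (W.baseChange K).toAffine.Point, ((2 : ℕ) : ℤ) • P = 0 → P = 0)
    {σ₀ : K ≃ₐ[ℚ] K} (hσ₀ : σ₀ ≠ 1)
    (Dt : ModularParametrizationData W (W.conductorNorm ℤ)) (β : ℤ) (ι : K →+* ℂ) (d₁ : KolyvaginHeegnerData Dt β ι 1)
    {M₀ : ℕ} (hM : 1 ≤ M₀)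
    (hdiv : ∃ Q : (W.baseChange (ringClassField K ι 1)).toAffine.Point, ((2 ^ M₀ : ℕ) : ℤ) • Q = d₁.derivedPoint)
    {ℓ : ℕ} (hKoly : Zhang2014.IsKolyvaginPrime (W.conductorNorm ℤ) W K 2 ℓ) :
    ∃ d : KolyvaginHeegnerData Dt β ι (1 * ℓ),
      (∀ s ∈ d₁.S, ∃ s' ∈ d.S, ∀ (x : ringClassField K ι 1) (x' : ringClassField K ι (1 * ℓ)),
          (x : ℂ) = x' → ((s' x' : ringClassField K ι (1 * ℓ)) : ℂ) = (s x : ℂ)) ∧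
      (∀ (x : ringClassField K ι 1) (x' : ringClassField K ι (1 * ℓ)), (x : ℂ) = x' → d.emb x' = d₁.emb x) ∧
      (∃! s : galH1Torsion W ((2 ^ 1 : ℕ) : ℤ),
        resTorsion W K ((2 ^ 1 : ℕ) : ℤ) s = d.kolyvaginClass Nat.prime_two 1 ∧ s ∈ W.selmerGroup ((2 ^ 1 : ℕ) : ℤ)) ∧
      (d.kolyvaginClass Nat.prime_two 1 ≠ 0 ↔
        ¬ ∃ Q : (W.baseChange (ringClassField K ι (1 * ℓ))).toAffine.Point, (2 : ℤ) • Q = d.derivedPoint) := by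
  have hℓ : ℓ.Prime := hKoly.1
  have hsurj : W.HasSurjectiveModNGaloisRep ((2 : ℤ) ^ 1) := by exact_mod_cast hρ 1
  obtain ⟨d, hS, -, hemb, hlam⟩ :=
    exists_compatible_kolyvaginClass_two_mem_selmerLocalKer_of_relation hQ2 hcm hρ hK hodd h3 hH Dt β ι d₁ hM hdiv hKoly
  -- the family `{1 ↦ d₁, 1·ℓ ↦ d}` over the divisors of `1·ℓ`
  have hone : ∀ m : ℕ, m ∣ 1 * ℓ → m ≠ 1 * ℓ → m = 1 := fun m hm hne ↦ by
    rw [one_mul] at hm hne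
    exact ((Nat.dvd_prime hℓ).mp hm).resolve_right hne
  let fam : (m : ℕ) → m ∣ 1 * ℓ → KolyvaginHeegnerData Dt β ι m := fun m hm ↦
    if h : m = 1 * ℓ then h ▸ d else (hone m hm h).symm ▸ d₁
  have hfam : fam (1 * ℓ) dvd_rfl = d := by simp [fam]
  have hn : Squarefree (1 * ℓ) := by rw [one_mul]; exact hℓ.squarefree
  have hkol : ∀ q ∈ (1 * ℓ).primeFactors, Zhang2014.IsKolyvaginPrime (W.conductorNorm ℤ) W K 2 q := by
    intro q hq
    rw [one_mul, hℓ.primeFactors, Finset.mem_singleton] at hq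
    subst hq
    exact hKoly
  have hlam' : ∀ v : HeightOneSpectrum (𝓞 K), (((1 * ℓ : ℕ) : ℕ) : 𝓞 K) ∈ v.asIdeal →
      (fam (1 * ℓ) dvd_rfl).kolyvaginClass Nat.prime_two 1 ∈
        selmerLocalKer (W.baseChange K) (v.adicCompletion K) ((2 ^ 1 : ℕ) : ℤ) := by
    intro v hv
    rw [hfam]
    exact hlam v (by simpa using hv)
  have h := existsUnique_resTorsion_eq_kolyvaginClass_two_of_cell_of_family (W := W) (K := K) hPT hEP hΔ hsurj hT h4 hK hodd h3 hH h2K hd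
    Wd hWd hSel hL hσ₀ hn hkol fam hlam'
  rw [hfam] at h
  exact ⟨d, hS, hemb, h.1, h.2⟩

end Summit.BirchSwinnertonDyer.BirchSwinnertonDyer.Theorems.GenusSupplyNarrow.KFourCell

end
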